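import Summits.BirchSwinnertonDyer.Rank1Residual.Iwasawa.CyclotomicLayerOneCubic
import HarnessLib

/-!
# X3, the DEGENERATE rows OFF the sub-locus: the SECOND layer group fixes `ζ₂₇` up to inversion, and
# fixes it on the nose on the stabiliser of `ζ₃` (cell `bsd-eis`, seat `bsd-eis-x3` gen 7; the `ζ₂₇`
# half of STEP 3 of the independence argument F5 for the layer T-side classes, MEMO-9 §2.4 (f):
# `κ⁻¹(9ℤ₃) ∩ Stab(ζ₃)` fixes `ζ₂₇`, so the layer character of `κ⁻¹(3ℤ₃) ∩ Stab(ζ₃)` is the Kummer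
# character of `ζ₉ = ζ₂₇³`; pattern of k5-c3's `CyclotomicLayerOneCubic` one level up; route K1
# `AdditiveBranchIMC`, crux `GordTwoRankZeroOffCaseOne` — supports only)

HONEST FRAMING (`run/shared/lean/pub/bsd-eis/README.md` §4): THEOREMS ONLY (no `def`, no named fact,
no `sorry`); nothing is booked; no label, tier or count of record moves.

* `toZModPow_three_sq_eq_one` — `σ ∈ κ_cyc⁻¹(9ℤ₃)` ⟹ `χ₃(σ)² ≡ 1 (mod 27)`;
* `smul_eq_or_eq_pow_26` — hence `σζ ∈ {ζ, ζ²⁶}` for `ζ²⁷ = 1`;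
* `smul_zeta27_eq_of_smul_pow_nine` — if moreover `σ` fixes `ζ⁹` (a primitive cube root of unity when
  `ζ` is a primitive `27`-th root of unity) then `σζ = ζ`;
* `smul_zeta27_eq_of_mem_layerSubgroup_two` — the same for every cyclotomic `κ` (unit twists).
References: [Washington1997] §13.1; [Serre1973] Ch. II §3.2.
-/

set_option autoImplicit false

noncomputable section

namespace Summit.BirchSwinnertonDyer.Rank1Residual.Additive

namespace LayerCharTower

open Field IntermediateField
open Literature.NumberTheory.GaloisRepresentations
open Literature.NumberTheory.EllipticCurves Literature.NumberTheory.EllipticCurves.PadicOneUnits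
  Literature.NumberTheory.EllipticCurves.CyclotomicZp
open Summit.BirchSwinnertonDyer.Rank1Residual.Iwasawa.CyclotomicLayerOne

/-- For `σ ∈ κ_cyc⁻¹(9ℤ₃)`: `χ₃(σ)² ≡ 1 (mod 27)`. [cite: Washington1997, §13.1]
[cite: Serre1973, Ch. II §3.2 Prop. 8] -/
theorem toZModPow_three_sq_eq_one {σ : absoluteGaloisGroup ℚ}
    (hσ : σ ∈ (zpExtension 3).layerSubgroup 2) :
    (PadicInt.toZModPow 3 ((GaloisRep.cyclotomicCharacter ℚ 3 σ : ℤ_[3]ˣ) : ℤ_[3])) ^ 2 = 1 := by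
  set u : ℤ_[3]ˣ := GaloisRep.cyclotomicCharacter ℚ 3 σ with hu
  -- `9 ∣ ℓ(u)`
  rw [ZpExtension.mem_layerSubgroup, zpExtension_apply, toAdd_ofAdd] at hσ
  obtain ⟨y, hy⟩ := hσ
  have ht : torsionOrder 3 = 2 := by
    rw [torsionOrder, cyclotomicExponent, if_neg (by decide), pow_one, Nat.totient_prime (by norm_num)]
  have he : cyclotomicExponent 3 - 1 = 0 := by rw [cyclotomicExponent, if_neg (by decide)]
  have h1 : cycPow 3 (torsionOrder 3 * ell 3 u) = (u : ℤ_[3]) ^ 2 := by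
    rw [cycPow_torsionOrder_mul_ell, ht]
  have h2 : ‖cycPow 3 (torsionOrder 3 * ell 3 u) - 1‖ =
      ‖(torsionOrder 3 : ℤ_[3]) * ell 3 u‖ * ‖(3 : ℤ_[3]) ^ (0 + 1)‖ := by
    have := norm_oneAddPow_sub_one (p := 3) 0 (by norm_num) ((torsionOrder 3 : ℤ_[3]) * ell 3 u)
    rw [cycPow, he]
    exact this
  rw [h1, ht, hy, zero_add, pow_one] at h2
  -- hence `‖u² − 1‖ ≤ ‖27‖`
  have h3 : ‖(u : ℤ_[3]) ^ 2 - 1‖ ≤ ‖(3 : ℤ_[3]) ^ 3‖ := by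
    rw [h2, show (3 : ℤ_[3]) ^ 3 = 3 ^ 2 * 3 by ring, norm_mul ((3 : ℤ_[3]) ^ 2)]
    refine mul_le_mul_of_nonneg_right ?_ (norm_nonneg _)
    calc ‖((2 : ℕ) : ℤ_[3]) * ((3 : ℤ_[3]) ^ 2 * y)‖
        = ‖((2 : ℕ) : ℤ_[3])‖ * (‖(3 : ℤ_[3]) ^ 2‖ * ‖y‖) := by rw [norm_mul, norm_mul]
      _ ≤ 1 * (‖(3 : ℤ_[3]) ^ 2‖ * 1) := by
          gcongr
          · exact PadicInt.norm_le_one _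
          · exact PadicInt.norm_le_one _
      _ = ‖(3 : ℤ_[3]) ^ 2‖ := by ring
  have h4 : (u : ℤ_[3]) ^ 2 - 1 ∈ Ideal.span {((3 : ℕ) : ℤ_[3]) ^ 3} := by
    rw [← PadicInt.norm_le_pow_iff_mem_span_pow]
    have hp : ‖(3 : ℤ_[3])‖ = ((3 : ℕ) : ℝ)⁻¹ := PadicInt.norm_p
    refine h3.trans (le_of_eq ?_)
    rw [norm_pow, hp, zpow_neg, zpow_natCast, inv_pow]
  rw [← PadicInt.ker_toZModPow, RingHom.mem_ker, map_sub, map_pow, map_one, sub_eq_zero] at h4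
  exact h4

/-- Square roots of `1` in `ℤ/27`: `x² = 1 ⇒ x = 1 ∨ x = 26`. [folklore] -/
theorem zmod27_sq_eq_one {x : ZMod 27} (hx : x ^ 2 = 1) : x = 1 ∨ x = 26 := by
  revert x hx; decide

/-- For `σ ∈ κ_cyc⁻¹(9ℤ₃)` and `ζ²⁷ = 1` in `ℚ̄`: `σζ = ζ` or `σζ = ζ²⁶`. [cite: Washington1997, §13.1] -/
theorem smul_eq_or_eq_pow_26 {σ : absoluteGaloisGroup ℚ} (hσ : σ ∈ (zpExtension 3).layerSubgroup 2)
    (ζ : AlgebraicClosure ℚ) (hζ : ζ ^ 27 = 1) : σ • ζ = ζ ∨ σ • ζ = ζ ^ 26 := by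
  haveI : NeZero ((3 : ℕ) : ℚ) := ⟨by norm_num⟩
  have hspec := GaloisRep.cyclotomicCharacter_spec ℚ 3 (k := 3) σ ζ (by simpa using hζ)
  rcases zmod27_sq_eq_one (toZModPow_three_sq_eq_one hσ) with h | h
  · left
    rw [hspec]
    have : (PadicInt.toZModPow 3 ((GaloisRep.cyclotomicCharacter ℚ 3 σ : ℤ_[3]ˣ) : ℤ_[3])).val = 1 := by
      rw [h]; decide
    rw [this, pow_one]
  · right
    rw [hspec]
    have : (PadicInt.toZModPow 3 ((GaloisRep.cyclotomicCharacter ℚ 3 σ : ℤ_[3]ˣ) : ℤ_[3])).val = 26 := by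
      rw [h]; decide
    rw [this]

/-- **`κ_cyc⁻¹(9ℤ₃) ∩ Stab(ζ₃)` fixes `ζ₂₇`**: for a primitive `27`-th root of unity `ζ` and
`σ ∈ κ_cyc⁻¹(9ℤ₃)` with `σζ⁹ = ζ⁹`, `σζ = ζ` (the alternative `σζ = ζ²⁶` would give
`σζ⁹ = ζ²³⁴ = ζ¹⁸ ≠ ζ⁹`). [cite: Washington1997, §13.1] -/
theorem smul_zeta27_eq_of_smul_pow_nine {σ : absoluteGaloisGroup ℚ}
    (hσ : σ ∈ (zpExtension 3).layerSubgroup 2) {ζ : AlgebraicClosure ℚ} (hζ : IsPrimitiveRoot ζ 27)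
    (h9 : σ • ζ ^ 9 = ζ ^ 9) : σ • ζ = ζ := by
  rcases smul_eq_or_eq_pow_26 hσ ζ hζ.pow_eq_one with h | h
  · exact h
  · exfalso
    rw [smul_pow', h, ← pow_mul, show 26 * 9 = 27 * 8 + 18 from rfl, pow_add, pow_mul,
      hζ.pow_eq_one, one_pow, one_mul] at h9
    -- `ζ¹⁸ = ζ⁹` forces `ζ⁹ = 1`
    have h0 : ζ ^ 9 ≠ 0 := pow_ne_zero 9 (hζ.ne_zero (by norm_num))
    have h1 : ζ ^ 9 * ζ ^ 9 = 1 * ζ ^ 9 := by rw [← pow_add, one_mul]; exact h9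
    have h91 : ζ ^ 9 = 1 := mul_right_cancel₀ h0 h1
    exact (hζ.pow_ne_one_of_pos_of_lt (by norm_num) (by norm_num)) h91

/-- **Every cyclotomic `κ`**: for `σ ∈ κ.layerSubgroup 2` (`κ` cyclotomic) fixing `ζ₂₇⁹`, `σ` fixes the
primitive `27`-th root of unity `ζ₂₇` (`κ` is a unit twist of `κ_cyc`, same layer subgroups).
[cite: Washington1997, §13.1] -/
theorem smul_zeta27_eq_of_mem_layerSubgroup_two {κ : ZpExtension ℚ 3} (hκ : κ.IsCyclotomic)
    {σ : absoluteGaloisGroup ℚ} (hσ : σ ∈ κ.layerSubgroup 2) {ζ : AlgebraicClosure ℚ}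
    (hζ : IsPrimitiveRoot ζ 27) (h9 : σ • ζ ^ 9 = ζ ^ 9) : σ • ζ = ζ := by
  obtain ⟨u, rfl⟩ := ZpExtension.IsCyclotomic.exists_eq_unitTwist_holds (isCyclotomic_zpExtension 3) hκ
  rw [ZpExtension.layerSubgroup_unitTwist] at hσ
  exact smul_zeta27_eq_of_smul_pow_nine hσ hζ h9

end LayerCharTower

end Summit.BirchSwinnertonDyer.Rank1Residual.Additive

end
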